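import Literature.NumberTheory.Automorphic.CDTTheorem722ThreeFactsProofs
import Literature.NumberTheory.EllipticCurves.IsogenyFrobeniusTraceHoldsProofs
import Literature.NumberTheory.EllipticCurves.CuspFormLFunctionLevelConductorProofs
import Literature.NumberTheory.EllipticCurves.CuspFormLFunctionLevelConductorOfCarayolProofs
import Literature.NumberTheory.EllipticCurves.Szpiro

/-! Stub-ideation sketch (ideator 3, FAMILY 3) for `stub_threeImpTwo` of crux `FreyModularity`:
helper-lemma STATEMENTS only (elaboration check). -/

set_option linter.dupNamespace false

noncomputable section

open scoped MatrixGroups NumberField ModularForm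

open CongruenceSubgroup NumberField IsDedekindDomain
open Literature.NumberTheory.EllipticCurves
open Literature.NumberTheory.EllipticCurves.ModularForms
open Literature.NumberTheory.Automorphic
open Literature.NumberTheory.Automorphic.BCDT
open Literature.NumberTheory.GaloisRepresentations
open WeierstrassCurve

namespace Summit.ABC.ABC.Cruxes.FreyModularity.Sketch.ThreeImpTwoIdeas3

/-- H1 — the registered stub from the EXISTENCE bullet of Eichler–Shimura only (lattice / Manin
clause of `eichlerShimuraConstruction` dropped) and Carayol's level theorem; copy of
`isModular_of_isModularGaloisRepTate_of_facts` (which discards the lattice clause: `obtain ⟨W', hW', hW'f, -⟩`). -/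
theorem threeImpTwo_of_curve_of_levelEq
    (hES₀ : ∀ {N : ℕ} [NeZero N] {f : CuspForm (Gamma0 N) 2}, IsNewform0 f →
      (∀ n : ℕ, ∃ a : ℤ, cuspCoeff f n = a) →
      ∃ (W : WeierstrassCurve ℚ) (_ : W.IsElliptic), IsNewformOf W f)
    (hC : ∀ (N : ℕ) [NeZero N], IsNewformOf.level_eq_conductorNorm (N := N)) :
    ∀ (W : WeierstrassCurve ℚ) [W.IsElliptic] [NeZero (W.conductorNorm ℤ)] (ℓ : ℕ) [Fact ℓ.Prime],
      W.IsModularGaloisRepTate ℓ → BCDT.IsModular W := by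
  intro W _ _ ℓ _ h
  classical
  have hℓp : ℓ.Prime := Fact.out
  obtain ⟨N, hN, f, hf, hint, hcoeff⟩ := exists_rational_isNewform0_of_isModularGaloisRepTate' W ℓ h
  haveI : NeZero (N * (ℓ * W.conductorNorm ℤ)) :=
    ⟨mul_ne_zero (NeZero.ne N) (mul_ne_zero hℓp.ne_zero (NeZero.ne _))⟩
  obtain ⟨W', hW', hW'f⟩ := hES₀ hf hint
  have hiso : IsIsogenous W W' := by
    refine WeierstrassCurve.isIsogenous_of_finite_setOf_LFunction_ne
      isIsogenous_iff_frobeniusTrace_eq_holds W W' ?_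
    refine (N * (ℓ * W.conductorNorm ℤ)).primeFactors.finite_toSet.subset ?_
    rintro p ⟨hp, hne⟩
    refine (Nat.mem_primeFactors_of_ne_zero (NeZero.ne _)).mpr ⟨hp, ?_⟩
    by_contra hpM
    exact hne (by exact_mod_cast (hcoeff p hp hpM).symm.trans (hW'f.2 p))
  have hWf : IsNewformOf W f := ⟨hf, fun n ↦ by rw [hW'f.2 n, hiso.LFunction_eq]⟩
  have hNE : N = W.conductorNorm ℤ := hC N hWf
  subst hNE
  exact ⟨f, hWf⟩

/-- H2 — PROVABLE NOW modulo `hES₀` alone: the stub on SEMISTABLE curves (squarefree conductor),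
Carayol replaced by the tree's `IsNewformOf.level_eq_conductorNorm_of_squarefree`. Covers the
`ℓ = 5` consumption (case-B Frey curves are semistable, `stub_freyCaseBSixteen`). -/
theorem threeImpTwo_of_curve_of_squarefree
    (hES₀ : ∀ {N : ℕ} [NeZero N] {f : CuspForm (Gamma0 N) 2}, IsNewform0 f →
      (∀ n : ℕ, ∃ a : ℤ, cuspCoeff f n = a) →
      ∃ (W : WeierstrassCurve ℚ) (_ : W.IsElliptic), IsNewformOf W f) :
    ∀ (W : WeierstrassCurve ℚ) [W.IsElliptic] [NeZero (W.conductorNorm ℤ)] (ℓ : ℕ) [Fact ℓ.Prime],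
      Squarefree (W.conductorNorm ℤ) → W.IsModularGaloisRepTate ℓ → BCDT.IsModular W := by
  intro W _ _ ℓ _ hsq h
  classical
  have hℓp : ℓ.Prime := Fact.out
  obtain ⟨N, hN, f, hf, hint, hcoeff⟩ := exists_rational_isNewform0_of_isModularGaloisRepTate' W ℓ h
  haveI : NeZero (N * (ℓ * W.conductorNorm ℤ)) :=
    ⟨mul_ne_zero (NeZero.ne N) (mul_ne_zero hℓp.ne_zero (NeZero.ne _))⟩
  obtain ⟨W', hW', hW'f⟩ := hES₀ hf hint
  have hiso : IsIsogenous W W' := by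
    refine WeierstrassCurve.isIsogenous_of_finite_setOf_LFunction_ne
      isIsogenous_iff_frobeniusTrace_eq_holds W W' ?_
    refine (N * (ℓ * W.conductorNorm ℤ)).primeFactors.finite_toSet.subset ?_
    rintro p ⟨hp, hne⟩
    refine (Nat.mem_primeFactors_of_ne_zero (NeZero.ne _)).mpr ⟨hp, ?_⟩
    by_contra hpM
    exact hne (by exact_mod_cast (hcoeff p hp hpM).symm.trans (hW'f.2 p))
  have hWf : IsNewformOf W f := ⟨hf, fun n ↦ by rw [hW'f.2 n, hiso.LFunction_eq]⟩
  have hNE : N = W.conductorNorm ℤ := hWf.level_eq_conductorNorm_of_squarefree hsq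
  subst hNE
  exact ⟨f, hWf⟩

/-- H3 — the stub for ONE curve from `hES₀`, the Galois-form Carayol fact and Saito's `p = 2`
leaf FOR THAT CURVE (vacuous when `W` has no additive place above `2`), via the tree's
`IsNewformOf.level_eq_conductorNorm_of_carayol1986_of_saito`. -/
theorem threeImpTwo_of_curve_of_carayol1986_of_saito
    (hES₀ : ∀ {N : ℕ} [NeZero N] {f : CuspForm (Gamma0 N) 2}, IsNewform0 f →
      (∀ n : ℕ, ∃ a : ℤ, cuspCoeff f n = a) →
      ∃ (W : WeierstrassCurve ℚ) (_ : W.IsElliptic), IsNewformOf W f)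
    (hCar : Carayol1986_artinConductorExponent) :
    ∀ (W : WeierstrassCurve ℚ) [W.IsElliptic] [NeZero (W.conductorNorm ℤ)] (ℓ : ℕ) [Fact ℓ.Prime],
      (∀ (ℓ' : ℕ) [Fact ℓ'.Prime],
        W.swanConductorAt_rationalTate_eq_wildConductorExponent_of_ringChar_eq_two ℓ') →
      W.IsModularGaloisRepTate ℓ → BCDT.IsModular W := by
  intro W _ _ ℓ _ hS h
  classical
  have hℓp : ℓ.Prime := Fact.out
  obtain ⟨N, hN, f, hf, hint, hcoeff⟩ := exists_rational_isNewform0_of_isModularGaloisRepTate' W ℓ h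
  haveI : NeZero (N * (ℓ * W.conductorNorm ℤ)) :=
    ⟨mul_ne_zero (NeZero.ne N) (mul_ne_zero hℓp.ne_zero (NeZero.ne _))⟩
  obtain ⟨W', hW', hW'f⟩ := hES₀ hf hint
  have hiso : IsIsogenous W W' := by
    refine WeierstrassCurve.isIsogenous_of_finite_setOf_LFunction_ne
      isIsogenous_iff_frobeniusTrace_eq_holds W W' ?_
    refine (N * (ℓ * W.conductorNorm ℤ)).primeFactors.finite_toSet.subset ?_
    rintro p ⟨hp, hne⟩
    refine (Nat.mem_primeFactors_of_ne_zero (NeZero.ne _)).mpr ⟨hp, ?_⟩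
    by_contra hpM
    exact hne (by exact_mod_cast (hcoeff p hp hpM).symm.trans (hW'f.2 p))
  have hWf : IsNewformOf W f := ⟨hf, fun n ↦ by rw [hW'f.2 n, hiso.LFunction_eq]⟩
  have hNE : N = W.conductorNorm ℤ := hWf.level_eq_conductorNorm_of_carayol1986_of_saito hCar hS
  subst hNE
  exact ⟨f, hWf⟩

/-- H3' — the same for a curve with no additive place of residue characteristic `2`
(Carayol1986 alone: `…_of_carayol1986_of_forall_not_hasAdditiveReductionAt_two`). -/
theorem threeImpTwo_of_curve_of_carayol1986_of_not_additive_two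
    (hES₀ : ∀ {N : ℕ} [NeZero N] {f : CuspForm (Gamma0 N) 2}, IsNewform0 f →
      (∀ n : ℕ, ∃ a : ℤ, cuspCoeff f n = a) →
      ∃ (W : WeierstrassCurve ℚ) (_ : W.IsElliptic), IsNewformOf W f)
    (hCar : Carayol1986_artinConductorExponent) :
    ∀ (W : WeierstrassCurve ℚ) [W.IsElliptic] [NeZero (W.conductorNorm ℤ)] (ℓ : ℕ) [Fact ℓ.Prime],
      (∀ w : HeightOneSpectrum (𝓞 ℚ), ringChar (𝓞 ℚ ⧸ w.asIdeal) = 2 →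
        ¬ W.HasAdditiveReductionAt w) →
      W.IsModularGaloisRepTate ℓ → BCDT.IsModular W := by
  intro W _ _ ℓ _ h2 h
  classical
  have hℓp : ℓ.Prime := Fact.out
  obtain ⟨N, hN, f, hf, hint, hcoeff⟩ := exists_rational_isNewform0_of_isModularGaloisRepTate' W ℓ h
  haveI : NeZero (N * (ℓ * W.conductorNorm ℤ)) :=
    ⟨mul_ne_zero (NeZero.ne N) (mul_ne_zero hℓp.ne_zero (NeZero.ne _))⟩
  obtain ⟨W', hW', hW'f⟩ := hES₀ hf hint
  have hiso : IsIsogenous W W' := by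
    refine WeierstrassCurve.isIsogenous_of_finite_setOf_LFunction_ne
      isIsogenous_iff_frobeniusTrace_eq_holds W W' ?_
    refine (N * (ℓ * W.conductorNorm ℤ)).primeFactors.finite_toSet.subset ?_
    rintro p ⟨hp, hne⟩
    refine (Nat.mem_primeFactors_of_ne_zero (NeZero.ne _)).mpr ⟨hp, ?_⟩
    by_contra hpM
    exact hne (by exact_mod_cast (hcoeff p hp hpM).symm.trans (hW'f.2 p))
  have hWf : IsNewformOf W f := ⟨hf, fun n ↦ by rw [hW'f.2 n, hiso.LFunction_eq]⟩
  have hNE : N = W.conductorNorm ℤ :=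
    hWf.level_eq_conductorNorm_of_carayol1986_of_forall_not_hasAdditiveReductionAt_two hCar h2
  subst hNE
  exact ⟨f, hWf⟩

/-- H4 — `fourTransfer` (Silverberg Prop. 7.1 at the prime `2`): semistability at `2` is read off
`E[5]`; verbatim `stub_nineTransfer` with `9 ↦ 4`, same proof (`stub_nineTransfer_torsion` is
stated for every place `v ∤ ℓ`, `ℓ ≥ 5`; `c_2 ≤ 4 < 5`). -/
theorem fourTransfer :
    ∀ (W W' : WeierstrassCurve ℚ) [W.IsElliptic] [W'.IsElliptic] (ρ : ModPGaloisRep ℚ (ZMod 5) 2),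
      W.IsTorsionGaloisRep 5 ρ → W'.IsTorsionGaloisRep 5 ρ →
      ¬ 4 ∣ W.conductorNorm ℤ → ¬ 4 ∣ W'.conductorNorm ℤ := by
  sorry

/-- H4' — `4 ∤ N_W` means no additive place above `2` (`sq_dvd_conductorNorm_iff_hasAdditiveReductionAt`
at `p = 2`), the hypothesis shape of H3'. -/
theorem forall_not_hasAdditiveReductionAt_two_of_not_four_dvd (W : WeierstrassCurve ℚ) [W.IsElliptic]
    (h4 : ¬ 4 ∣ W.conductorNorm ℤ) :
    ∀ w : HeightOneSpectrum (𝓞 ℚ), ringChar (𝓞 ℚ ⧸ w.asIdeal) = 2 → ¬ W.HasAdditiveReductionAt w := by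
  sorry

/-- H5 — Saito's `p = 2` leaf ON THE FREY FAMILY (certified computation of the extreme place):
`Sw_𝔓(V_ℓ E_(a,b)) = δ₂(E_(a,b))` for every Frey curve and every `ℓ`, from the tree's `2`-adic Swan
tables for `E[3]` (`stub_freySwanOdd`'s leaves, `ThreeTorsionSwanAtTwoClass…`), transport to `V_ℓ`
(`swanConductorAt_rationalTate_eq_swanConductorAt_torsion`, `ℓ`-independence) and Tate's algorithm
(`wildConductorExponent_freyCurve_two_eq_one`, …); vacuous on the classes not additive at `2`. -/
theorem freySaito :
    ∀ (a b : ℤ) [(freyCurve a b).IsElliptic], IsCoprime a b → a * b * (a + b) ≠ 0 →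
      ∀ (ℓ : ℕ) [Fact ℓ.Prime],
        (freyCurve a b).swanConductorAt_rationalTate_eq_wildConductorExponent_of_ringChar_eq_two ℓ := by
  sorry

/-- H5a — the half of H5 that is a PROVED engine of the tree: for `16 ∣ ab(a+b)` the Frey curve has
`ord₂ j = 8 - 2·ord₂(ab(a+b)) ≤ 0`, so `swanConductorAt_rationalTate_eq_wildConductorExponent_of_ringChar_eq_two_of_one_le_valuation_j'`
(twists of Tate / ordinary normal forms) applies; what is left to prove is the `2`-adic valuation of
`j(E_(a,b)) = 2⁸ (a²+ab+b²)³ / (ab(a+b))²`. Covers instance I3 (case B ⇒ `16 ∣ B`, S12/S17). -/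
theorem freySaito_of_sixteen_dvd :
    ∀ (a b : ℤ) [(freyCurve a b).IsElliptic], IsCoprime a b → a * b * (a + b) ≠ 0 →
      (16 : ℤ) ∣ a * b * (a + b) →
      ∀ (ℓ : ℕ) [Fact ℓ.Prime],
        (freyCurve a b).swanConductorAt_rationalTate_eq_wildConductorExponent_of_ringChar_eq_two ℓ := by
  sorry

/-- H6 — Saito's `p = 2` leaf for the `-1`-twist of a curve not additive at `2` (the shape of the
switched curve `W'` for an un-normalised case-B pair: `W' ⊗ χ₋₁` shares `E₀[5]` with the normalised,
semistable-at-`2` Frey curve `E₀`, so `4 ∤ N_{W' ⊗ χ₋₁}` by H4): `V` multiplicative or good ordinary at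
`2` ⇒ `…_of_one_le_valuation_j'` (`j` is twist-invariant); `V` good supersingular ⇒ the `χ₋₁`-branch
`(II*, 12)` of `OggFormulaTwistTameIIstarTwoProofs`. -/
theorem saito_quadraticTwist_neg_one_of_not_four_dvd :
    ∀ (V : WeierstrassCurve ℚ) [V.IsElliptic], ¬ 4 ∣ V.conductorNorm ℤ →
      ∀ (ℓ : ℕ) [Fact ℓ.Prime],
        (V.quadraticTwist (-1)).swanConductorAt_rationalTate_eq_wildConductorExponent_of_ringChar_eq_two ℓ := by
  sorry

/-- Assembly check: H3 + H4 + H4' + H5 give every INSTANCE of `h32` the composition consumes,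
modulo `hES₀ + Carayol1986` — here the `ℓ = 3` instance on a switched curve `W'` of a semistable `E`. -/
example
    (hES₀ : ∀ {N : ℕ} [NeZero N] {f : CuspForm (Gamma0 N) 2}, IsNewform0 f →
      (∀ n : ℕ, ∃ a : ℤ, cuspCoeff f n = a) →
      ∃ (W : WeierstrassCurve ℚ) (_ : W.IsElliptic), IsNewformOf W f)
    (hCar : Carayol1986_artinConductorExponent)
    (E W' : WeierstrassCurve ℚ) [E.IsElliptic] [W'.IsElliptic] [NeZero (W'.conductorNorm ℤ)]
    (ρ : ModPGaloisRep ℚ (ZMod 5) 2) (hρ : E.IsTorsionGaloisRep 5 ρ) (hρ' : W'.IsTorsionGaloisRep 5 ρ)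
    (h4 : ¬ 4 ∣ E.conductorNorm ℤ) (hmod : W'.IsModularGaloisRepTate 3) : BCDT.IsModular W' :=
  threeImpTwo_of_curve_of_carayol1986_of_not_additive_two hES₀ hCar W' 3
    (forall_not_hasAdditiveReductionAt_two_of_not_four_dvd W' (fourTransfer E W' ρ hρ hρ' h4)) hmod

end Summit.ABC.ABC.Cruxes.FreyModularity.Sketch.ThreeImpTwoIdeas3

end
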